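import Literature.Probability.RandomPlanarGeometry.SAWStripPartitionFunction
import HarnessLib

/-!
# Round trips grow at most linearly — stub `stub_roundTripLinear` of line `rectangle-windows`
(crux EdgeOfPositivity, stmt-CriticalPhenomena-11344)

Pure finite-sum algebra over `ℝ`.  At a width `W ≥ 2` whose predecessor strip (width `W - 1`) is
subcritical in the ε-free sense `x · Thr[x, W-1, j] ≤ 1` for every span `j`, and for a fugacity
`0 < x ≤ 1`, the fresh-column connector bound
`x^{r+s} · Zs[x, W-1, j, (0,r), (j,s)] ≤ Thr[x, W-1, j+2]` (rows `1 ≤ r, s ≤ W-1`) makes every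
`(W-1)`-strip point-to-point function uniformly bounded: `Zs[x, W-1, j, (0,r), (j,s)] ≤ 1 / x^{2W}`
(`zs_le_one_div_pow`).  Plugging this into the two-sided round-trip decomposition (a hypothesis)
bounds each of its `ℓ + 1` summands by `W · (1 / x^{2W})²`, whence the round-trip function
`Zs[x, W, ℓ, (0,W), (0,1)]` is at most `C · (ℓ + 1)` with `C = W / x^{4W}`.
Sources: folklore lattice combinatorics (only `Finset` sum manipulations are used here).
-/

noncomputable section

open Finset
open Literature.Probability.LatticeModels Literature.Probability.RandomPlanarGeometry

namespace Summit.CriticalPhenomena.SAWScalingLimit.Theorems.EdgeOfPositivity.RectangleWindows.RoundTripLinear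

local notation3 (prettyPrint := false) "Zs[" x ", " n ", " ℓ ", " a ", " b "]" =>
  (∑ s ∈ Finset.range ((ℓ + 1) * n + 1), (x : ℝ) ^ s * ((SAW.stripSAWs n ℓ s a b).card : ℝ))

local notation3 (prettyPrint := false) "Thr[" x ", " n ", " ℓ "]" =>
  (∑ s ∈ Finset.range ((ℓ + 1) * n + 1),
    (x : ℝ) ^ s * ((SAW.stripSAWs n ℓ s (![0, 1] : Site 2) (![((ℓ : ℕ) : ℤ), 1] : Site 2)).card : ℝ))

/-- Box partition functions are nonnegative for `x ≥ 0` (a finite sum of nonnegative terms).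
[folklore] -/
theorem zs_nonneg {x : ℝ} (hx : 0 ≤ x) (n ℓ : ℕ) (a b : Site 2) : 0 ≤ Zs[x, n, ℓ, a, b] :=
  sum_nonneg fun s _ => mul_nonneg (pow_nonneg hx s) (Nat.cast_nonneg _)

/-- **Uniform bound on the predecessor-strip point-to-point functions.**  From the connector
bound `x^{r+s} · Z ≤ Thr[j+2]`, subcriticality `x · Thr[j+2] ≤ 1` and `0 < x ≤ 1`:
`x^{2W} · Z ≤ x^{r+s+1} · Z ≤ 1`, so `Z ≤ 1 / x^{2W}`. [folklore] -/
theorem zs_le_one_div_pow {x : ℝ} {W : ℕ} (hx : 0 < x) (hx1 : x ≤ 1)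
    (hsub : ∀ j : ℕ, x * Thr[x, W - 1, j] ≤ 1)
    (hT1 : ∀ (j : ℕ) (r s : ℤ), 1 ≤ r → r ≤ ((W - 1 : ℕ) : ℤ) → 1 ≤ s → s ≤ ((W - 1 : ℕ) : ℤ) →
      x ^ (r + s).toNat * Zs[x, W - 1, j, ![0, r], ![(j : ℤ), s]] ≤ Thr[x, W - 1, j + 2])
    (j : ℕ) (r s : ℤ) (hr1 : 1 ≤ r) (hr : r ≤ (W : ℤ) - 1) (hs1 : 1 ≤ s) (hs : s ≤ (W : ℤ) - 1) :
    Zs[x, W - 1, j, ![0, r], ![(j : ℤ), s]] ≤ 1 / x ^ (2 * W) := by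
  have hZ := zs_nonneg hx.le (W - 1) j ![0, r] ![(j : ℤ), s]
  have h1 := hT1 j r s hr1 (by omega) hs1 (by omega)
  have h2 := hsub (j + 2)
  have he : (r + s).toNat + 1 ≤ 2 * W := by omega
  have hpow : x ^ (2 * W) ≤ x ^ ((r + s).toNat + 1) := pow_le_pow_of_le_one hx.le hx1 he
  have h3 : x ^ ((r + s).toNat + 1) * Zs[x, W - 1, j, ![0, r], ![(j : ℤ), s]] ≤ 1 := by
    calc x ^ ((r + s).toNat + 1) * Zs[x, W - 1, j, ![0, r], ![(j : ℤ), s]]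
        = x * (x ^ (r + s).toNat * Zs[x, W - 1, j, ![0, r], ![(j : ℤ), s]]) := by ring
      _ ≤ x * Thr[x, W - 1, j + 2] := mul_le_mul_of_nonneg_left h1 hx.le
      _ ≤ 1 := h2
  have h4 : x ^ (2 * W) * Zs[x, W - 1, j, ![0, r], ![(j : ℤ), s]] ≤ 1 :=
    (mul_le_mul_of_nonneg_right hpow hZ).trans h3
  rw [le_div_iff₀ (pow_pos hx _)]
  linarith [h4]

/-- **RL · round trips grow at most linearly at a width with subcritical predecessor** (finite-sum
algebra, no walks).  From the two-sided decomposition (hypothesis `h2`), the fresh-column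
connector bound (hypothesis `hT1`) and ε-free subcriticality of the `(W-1)`-strip
(`x · Thr ≤ 1`): every `(W-1)`-strip point-to-point function is `≤ 1 / x^{2W}` (`0 < x ≤ 1`), so
each of the `ℓ+1` summands is `≤ W / x^{4W}`, whence `Z(TL→BL; W, ℓ) ≤ C (ℓ+1)`. [folklore] -/
theorem stub_roundTripLinear :
    ∀ (x : ℝ) (W : ℕ), 0 < x → x ≤ 1 → 2 ≤ W →
      (∀ j : ℕ, x * Thr[x, W - 1, j] ≤ 1) →
      (∀ (j : ℕ) (r s : ℤ), 1 ≤ r → r ≤ ((W - 1 : ℕ) : ℤ) → 1 ≤ s → s ≤ ((W - 1 : ℕ) : ℤ) →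
        x ^ (r + s).toNat * Zs[x, W - 1, j, ![0, r], ![(j : ℤ), s]] ≤ Thr[x, W - 1, j + 2]) →
      (∀ ℓ : ℕ, Zs[x, W, ℓ, ![0, (W : ℤ)], ![0, 1]] ≤
        ∑ j ∈ Finset.range (ℓ + 1),
          ((∑ s ∈ Finset.Icc (1 : ℤ) ((W : ℤ) - 2),
              Zs[x, W - 1, j, ![0, (W : ℤ) - 1], ![(j : ℤ), s]] *
                Zs[x, W - 1, j, ![0, 1], ![(j : ℤ), s + 1]]) +
            Zs[x, W - 1, j, ![0, (W : ℤ) - 1], ![(j : ℤ), (W : ℤ) - 1]] * x *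
              Zs[x, W - 1, j, ![0, 1], ![(j : ℤ), (W : ℤ) - 1]])) →
      ∃ C : ℝ, 0 ≤ C ∧ ∀ ℓ : ℕ, Zs[x, W, ℓ, ![0, (W : ℤ)], ![0, 1]] ≤ C * ((ℓ : ℝ) + 1) := by
  intro x W hx hx1 hW hsub hT1 h2
  -- the uniform bound `K` on every predecessor-strip point-to-point function in `h2`
  have hK : ∀ (j : ℕ) (r s : ℤ), 1 ≤ r → r ≤ (W : ℤ) - 1 → 1 ≤ s → s ≤ (W : ℤ) - 1 →
      Zs[x, W - 1, j, ![0, r], ![(j : ℤ), s]] ≤ 1 / x ^ (2 * W) :=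
    fun j r s hr1 hr hs1 hs => zs_le_one_div_pow hx hx1 hsub hT1 j r s hr1 hr hs1 hs
  have hK0 : (0 : ℝ) ≤ 1 / x ^ (2 * W) := by positivity
  have hW1 : (1 : ℤ) ≤ (W : ℤ) - 1 := by omega
  -- number of inner terms
  have hcard : (Finset.Icc (1 : ℤ) ((W : ℤ) - 2)).card + 1 ≤ W := by
    rw [Int.card_Icc]; omega
  have hcardR : ((Finset.Icc (1 : ℤ) ((W : ℤ) - 2)).card : ℝ) + 1 ≤ (W : ℝ) := by
    exact_mod_cast hcard
  refine ⟨(W : ℝ) * (1 / x ^ (2 * W)) ^ 2, by positivity, fun ℓ => (h2 ℓ).trans ?_⟩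
  -- each `j`-summand is at most `W · K²`
  have hsummand : ∀ j ∈ Finset.range (ℓ + 1),
      (∑ s ∈ Finset.Icc (1 : ℤ) ((W : ℤ) - 2),
          Zs[x, W - 1, j, ![0, (W : ℤ) - 1], ![(j : ℤ), s]] *
            Zs[x, W - 1, j, ![0, 1], ![(j : ℤ), s + 1]]) +
        Zs[x, W - 1, j, ![0, (W : ℤ) - 1], ![(j : ℤ), (W : ℤ) - 1]] * x *
          Zs[x, W - 1, j, ![0, 1], ![(j : ℤ), (W : ℤ) - 1]] ≤
      (W : ℝ) * (1 / x ^ (2 * W)) ^ 2 := by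
    intro j _
    have hinner : ∑ s ∈ Finset.Icc (1 : ℤ) ((W : ℤ) - 2),
        Zs[x, W - 1, j, ![0, (W : ℤ) - 1], ![(j : ℤ), s]] *
          Zs[x, W - 1, j, ![0, 1], ![(j : ℤ), s + 1]] ≤
        (Finset.Icc (1 : ℤ) ((W : ℤ) - 2)).card • (1 / x ^ (2 * W)) ^ 2 := by
      refine Finset.sum_le_card_nsmul _ _ _ fun s hs => ?_
      rw [Finset.mem_Icc] at hs
      have hU := hK j ((W : ℤ) - 1) s hW1 le_rfl hs.1 (by omega)
      have hV := hK j 1 (s + 1) le_rfl hW1 (by omega) (by omega)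
      have hV0 := zs_nonneg hx.le (W - 1) j ![0, 1] ![(j : ℤ), s + 1]
      calc Zs[x, W - 1, j, ![0, (W : ℤ) - 1], ![(j : ℤ), s]] *
            Zs[x, W - 1, j, ![0, 1], ![(j : ℤ), s + 1]]
          ≤ (1 / x ^ (2 * W)) * (1 / x ^ (2 * W)) := mul_le_mul hU hV hV0 hK0
        _ = (1 / x ^ (2 * W)) ^ 2 := by ring
    have hlast : Zs[x, W - 1, j, ![0, (W : ℤ) - 1], ![(j : ℤ), (W : ℤ) - 1]] * x *
        Zs[x, W - 1, j, ![0, 1], ![(j : ℤ), (W : ℤ) - 1]] ≤ (1 / x ^ (2 * W)) ^ 2 := by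
      have hU := hK j ((W : ℤ) - 1) ((W : ℤ) - 1) hW1 le_rfl hW1 le_rfl
      have hV := hK j 1 ((W : ℤ) - 1) le_rfl hW1 hW1 le_rfl
      have hU0 := zs_nonneg hx.le (W - 1) j ![0, (W : ℤ) - 1] ![(j : ℤ), (W : ℤ) - 1]
      have hV0 := zs_nonneg hx.le (W - 1) j ![0, 1] ![(j : ℤ), (W : ℤ) - 1]
      calc Zs[x, W - 1, j, ![0, (W : ℤ) - 1], ![(j : ℤ), (W : ℤ) - 1]] * x *
            Zs[x, W - 1, j, ![0, 1], ![(j : ℤ), (W : ℤ) - 1]]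
          ≤ (1 / x ^ (2 * W)) * 1 * (1 / x ^ (2 * W)) :=
            mul_le_mul (mul_le_mul hU hx1 hx.le hK0) hV hV0 (by positivity)
        _ = (1 / x ^ (2 * W)) ^ 2 := by ring
    rw [nsmul_eq_mul] at hinner
    calc _ ≤ ((Finset.Icc (1 : ℤ) ((W : ℤ) - 2)).card : ℝ) * (1 / x ^ (2 * W)) ^ 2 +
          (1 / x ^ (2 * W)) ^ 2 := add_le_add hinner hlast
      _ = (((Finset.Icc (1 : ℤ) ((W : ℤ) - 2)).card : ℝ) + 1) * (1 / x ^ (2 * W)) ^ 2 := by ring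
      _ ≤ (W : ℝ) * (1 / x ^ (2 * W)) ^ 2 :=
          mul_le_mul_of_nonneg_right hcardR (by positivity)
  calc _ ≤ ∑ _j ∈ Finset.range (ℓ + 1), (W : ℝ) * (1 / x ^ (2 * W)) ^ 2 :=
        Finset.sum_le_sum hsummand
    _ = (W : ℝ) * (1 / x ^ (2 * W)) ^ 2 * ((ℓ : ℝ) + 1) := by
        rw [Finset.sum_const, Finset.card_range, nsmul_eq_mul, Nat.cast_add_one]
        ring

end Summit.CriticalPhenomena.SAWScalingLimit.Theorems.EdgeOfPositivity.RectangleWindows.RoundTripLinear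

end
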